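import Literature.NumberTheory.LFunctions.DedekindZetaRealZeroHoffsteinWindow
import Literature.NumberTheory.LFunctions.PrimitiveQuadraticCharacterPrimeValues
import Literature.NumberTheory.LFunctions.ExplicitLandauPageFamilyProofs
import Literature.NumberTheory.QuadraticFields.FundamentalDiscriminant
import Literature.NumberTheory.QuadraticFields.QuadraticDedekindZetaZeros
import HarnessLib

/-!
# Hoffstein's real-zero window for a real Dirichlet character: at most one real zero `β` of
# `L(s, χ)` (`χ` quadratic, `χ ≠ χ₀`, mod `q`) with `1 − β < (6 − 4√2)/log q` — PROVED; and
# Thorner–Zaman 2024 Corollary 2.5 from Lemma 2.4 + Platt 2016 alone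

Topic `Literature/NumberTheory/LFunctions` (namespace `Literature.NumberTheory.LFunctions`; helper
lemmas in the sub-namespace `HoffsteinWindow`). PROOF-ONLY module (D-0014/D-0026, kernel lane):
theorems, no definitions, no named facts. Cell `landau-siegel` §C (typer pool), OFFER-C 2026-08-27.

## What is proved, and from what

1. **Realisation glue** (`HoffsteinWindow.exists_quadraticField`): for a PRIMITIVE quadratic
   Dirichlet character `χ ≠ χ₀` mod `q` there is a quadratic number field `K` with `|d_K| = q` and
   `ζ_K(s) = ζ(s) L(s, χ)` for every `s ≠ 1` (continued functions: the tree's `dedekindZetaCont` and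
   Mathlib's `DirichletCharacter.LFunction`). Assembled from tree theorems only: the Montgomery–Vaughan
   Thm 9.13 dictionary PROVED in `PrimitiveQuadraticCharacter{Kronecker,KroneckerEven,PrimeValues}.lean`
   (`D = χ(−1) q` is a fundamental discriminant, `χ(n) = (D/n)` at odd `n`, the mod-`8` rule at `2`),
   the bijection quadratic fields ↔ fundamental discriminants (`Quadratic.exists_numberField_discr_eq`),
   and the factorisation `ζ_K = ζ · L(κ)` from the prime values of `κ`
   (`Quadratic.dedekindZeta_eq_riemannZeta_mul_LSeries_of_kronecker`, continued by
   `Quadratic.dedekindZetaCont_eq_riemannZeta_mul_LFunction`). [cite: MontgomeryVaughan2007, Theorem 9.13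
   and §10.1 Exercise 26]
2. **Hoffstein's window for `L(s, χ)`** (`realZeros_hoffsteinWindow_subsingleton`,
   `min_realZeros_le_of_isPrimitive`, `min_realZeros_le_of_isQuadratic`): Hoffstein 1980 Lemma 2 = Chen
   2007 Lemma 1 (PROVED in the tree as `chen2007_lemma1`, sibling module
   `DedekindZetaRealZeroHoffsteinWindow.lean`) applied to `K = ℚ(√D)`: since `ζ_K(β) = ζ(β)L(β, χ)`, two
   distinct real zeros `β ≠ β'` of `L(s, χ)` satisfy `min(β, β') ≤ 1 − (6 − 4√2)/log q`
   (`6 − 4√2 = 0.343 14…`); for an imprimitive quadratic `χ ≠ χ₀` mod `q` the same follows from its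
   primitive character `χ*` mod `q* ∣ q` (`L(s, χ) = L(s, χ*) ∏_{p∣q}(1 − χ*(p)p^{−s})`, Mathlib
   `DirichletCharacter.LFunction_changeLevel`; the Euler factors do not vanish at real `s > 0`;
   `log q* ≤ log q`). This is Hoffstein's own use of Lemma 2 (proof of Lemma 3, p. 170: the quadratic
   and biquadratic fields). [cite: Hoffstein1980SiegelTatuzawa, Lemma 2 p. 169 and p. 170]
   [cite: Chen2007SiegelTatuzawaHoffstein, Lemma 1 p. 362]
3. **Thorner–Zaman 2024, Corollary 2.5 from Lemma 2.4 and Platt 2016 only**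
   (`thornerZaman2024_corollary25_of_lemma24_platt`): the tree's
   `thornerZaman2024_corollary25_of_lemma24_platt_singlePage` (`ExplicitLandauPageFamilyProofs.lean`)
   derives the named fact `thornerZaman2024_corollary25` from `thornerZaman2024_lemma24` (McCurley's
   explicit Landau lemma), `platt2016_theorem71/72`, and an INLINE single-character Page binder "two
   distinct real zeros of one quadratic `L(s, χ)`, `χ ≠ χ₀` mod `q ≥ 3`, have
   `min{β, β'} ≤ 1 − c₁/log q`" for any `c₁ > pageConst = 0.155…` (in print: Morrill–Trudgian 2020).
   Item 2 DISCHARGES that binder with `c₁ = 6 − 4√2 = 0.343… > 1/5 > pageConst`, so Corollary 2.5 rests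
   on Lemma 2.4 + Platt alone. [cite: ThornerZaman2024LogFree, Corollary 2.5]

«The programme SEARCHES and TYPES; no claim about Landau–Siegel zeros, Theorems 1–2 of
arXiv:2211.02515 or a repaired Margin232 until a kernel theorem says so.»

## References

* [Hoffstein1980SiegelTatuzawa] J. Hoffstein, *On the Siegel–Tatuzawa theorem*, Acta Arith. 38 (1980)
  167–174 — Lemma 2 p. 169; proof of Lemma 3 p. 170.
* [Chen2007SiegelTatuzawaHoffstein] Y.-G. Chen, Acta Arith. 130 (2007) 361–367 — Lemma 1 p. 362.
* [MontgomeryVaughan2007] H. L. Montgomery, R. C. Vaughan, *Multiplicative Number Theory I*, CUP 2007 —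
  Theorem 9.13, §10.1 Exercise 26.
* [ThornerZaman2024LogFree] J. Thorner, A. Zaman, *An explicit version of Bombieri's log-free density
  estimate and Sarnak's rigidity conjecture*, Forum Math. 2024 = arXiv:2208.11123 — Lemma 2.4,
  Corollary 2.5.
-/

noncomputable section

open scoped NumberField NumberTheorySymbols
open Complex Set NumberField DirichletCharacter

namespace Literature.NumberTheory.LFunctions

namespace HoffsteinWindow

open Literature.NumberTheory.QuadraticFields.Quadratic
open Literature.NumberTheory.LFunctions.PrimitiveQuadratic

/-! ### Realisation: a primitive quadratic `χ` mod `q` is the Kronecker character of a quadratic field -/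

/-- A primitive character `χ ≠ 1` has modulus `> 1`. [folklore] -/
private theorem one_lt_level {q : ℕ} [NeZero q] {χ : DirichletCharacter ℂ q} (h1 : χ ≠ 1) : 1 < q := by
  have hq0 : q ≠ 0 := NeZero.ne q
  by_contra h
  have hq : q = 1 := by omega
  subst hq
  exact h1 (level_one χ)

/-- **Realisation with factorisation.** For `χ` primitive quadratic, `χ ≠ χ₀`, mod `q`: there is a
number field `K` of degree `2` with `|d_K| = q` (indeed `d_K = χ(−1) q`) and
`ζ_K(s) = ζ(s) L(s, χ)` for all `s ≠ 1`. [cite: MontgomeryVaughan2007, Theorem 9.13 and §10.1 Exercise 26] -/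
theorem exists_quadraticField {q : ℕ} [NeZero q] {χ : DirichletCharacter ℂ q}
    (hprim : χ.IsPrimitive) (hquad : χ.IsQuadratic) (h1 : χ ≠ 1) :
    ∃ (K : Type) (_ : Field K) (_ : NumberField K), Module.finrank ℚ K = 2 ∧
      (NumberField.discr K).natAbs = q ∧
      ∀ s : ℂ, s ≠ 1 → dedekindZetaCont K s = riemannZeta s * χ.LFunction s := by
  have hq1 : 1 < q := one_lt_level h1
  obtain ⟨sgn, hsgn', hsgn⟩ := exists_sign_eq χ
  have hs1 : sgn = 1 ∨ sgn = -1 := by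
    rcases hsgn' with ⟨h, -⟩ | ⟨h, -⟩
    · exact Or.inl h
    · exact Or.inr h
  have hfd := isFundamentalDiscriminant_sign_mul hprim hquad hsgn hs1 hq1
  obtain ⟨K, hF, hNF, h2, hdK⟩ := exists_numberField_discr_eq hfd
  refine ⟨K, hF, hNF, h2, ?_, ?_⟩
  · rw [hdK]
    rcases hs1 with rfl | rfl <;> simp
  · -- the factorisation on `Re s > 1` from the prime values of `χ`
    have hfac : ∀ s : ℂ, 1 < s.re →
        NumberField.dedekindZeta K s = riemannZeta s * LSeries (fun n ↦ χ n) s := by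
      intro s hs
      refine dedekindZeta_eq_riemannZeta_mul_LSeries_of_kronecker h2 χ (fun p hp hp2 ↦ ?_) ?_ hs
      · rw [hdK]
        exact apply_natCast_eq_jacobiSym_sign_mul hprim hquad hsgn hs1 (hp.odd_of_ne_two hp2)
      · rw [hdK]
        rcases Nat.even_or_odd q with heven | hodd
        · -- even modulus: `χ(2) = 0`, `D = ±q` even
          rw [apply_two_of_even heven χ]
          obtain ⟨k, hk⟩ := heven
          have hD2 : (sgn * (q : ℤ)) % 8 ≠ 1 ∧ (sgn * (q : ℤ)) % 8 ≠ 5 := by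
            have hq : (q : ℤ) = k + k := by exact_mod_cast hk
            rcases hs1 with rfl | rfl <;> omega
          rw [if_neg hD2.1, if_neg hD2.2]
        · rw [apply_two_eq_ite_sign_mul hodd hq1 hprim hquad hsgn hs1]
          rcases sign_mul_mod_eight hodd hq1 hprim hquad hsgn hs1 with h | h
          · rw [if_pos h, if_pos h]
          · rw [if_neg (by omega), if_neg (by omega), if_pos h]
    intro s hs
    exact dedekindZetaCont_eq_riemannZeta_mul_LFunction h1 hfac hs

/-- A real zero of `L(s, χ)` (`χ ≠ χ₀`) lies to the left of `1`. [folklore] -/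
private theorem realZero_lt_one {q : ℕ} [NeZero q] {χ : DirichletCharacter ℂ q} (h1 : χ ≠ 1) {β : ℝ}
    (hz : χ.LFunction β = 0) : β < 1 := by
  by_contra h
  exact DirichletCharacter.LFunction_ne_zero_of_one_le_re χ (Or.inl h1) (by simpa using not_lt.mp h) hz

/-! ### Hoffstein's window for a primitive quadratic character -/

/-- **At most one real zero of `L(s, χ)` in Hoffstein's window** (`χ` primitive quadratic, `χ ≠ χ₀`,
mod `q`): the real zeros `β` with `1 − β < (6 − 4√2)/log q` form a subsingleton. (Hoffstein's
Lemma 2 = Chen's Lemma 1 for the quadratic field `K` with `ζ_K = ζ · L(χ)`, `|d_K| = q`: a real zero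
of `L(s, χ)` is a real zero of `ζ₁_K = (s−1)ζ_K`.)
[cite: Hoffstein1980SiegelTatuzawa, Lemma 2 p. 169] [cite: Chen2007SiegelTatuzawaHoffstein, Lemma 1 p. 362] -/
theorem realZeros_subsingleton {q : ℕ} [NeZero q] {χ : DirichletCharacter ℂ q}
    (hprim : χ.IsPrimitive) (hquad : χ.IsQuadratic) (h1 : χ ≠ 1) :
    {β : ℝ | χ.LFunction β = 0 ∧ 1 - β < (6 - 4 * Real.sqrt 2) / Real.log q}.Subsingleton := by
  obtain ⟨K, hF, hNF, h2, hdq, hfac⟩ := exists_quadraticField hprim hquad h1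
  obtain ⟨hsub, -⟩ := chen2007_lemma1 K (by omega)
  rw [hdq] at hsub
  -- a real zero of `L(s, χ)` is a real zero of `ζ₁_K`
  have hzero : ∀ β : ℝ, χ.LFunction β = 0 → dedekindZeta₁ K β = 0 := by
    intro β hz
    have hβ1 : (β : ℂ) ≠ 1 := by
      have hlt := realZero_lt_one h1 hz
      intro h
      have := congrArg Complex.re h
      simp at this
      linarith
    rw [dedekindZeta₁_apply_of_ne_one hβ1, hfac β hβ1, hz, mul_zero, mul_zero]
  intro β hβ β' hβ'
  exact hsub ⟨hzero β hβ.1, hβ.2⟩ ⟨hzero β' hβ'.1, hβ'.2⟩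

end HoffsteinWindow

open HoffsteinWindow

/-- **Hoffstein's window, primitive case, Page shape**: for `χ` primitive quadratic, `χ ≠ χ₀`, mod
`q`, two distinct real zeros `β ≠ β'` of `L(s, χ)` satisfy `min{β, β'} ≤ 1 − (6 − 4√2)/log q`.
[cite: Hoffstein1980SiegelTatuzawa, Lemma 2 p. 169] [cite: Chen2007SiegelTatuzawaHoffstein, Lemma 1 p. 362] -/
theorem min_realZeros_le_of_isPrimitive {q : ℕ} [NeZero q] {χ : DirichletCharacter ℂ q}
    (hprim : χ.IsPrimitive) (hquad : χ.IsQuadratic) (h1 : χ ≠ 1) {β β' : ℝ} (hne : β ≠ β')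
    (hz : χ.LFunction β = 0) (hz' : χ.LFunction β' = 0) :
    min β β' ≤ 1 - (6 - 4 * Real.sqrt 2) / Real.log q := by
  by_contra h
  have hlt := lt_of_not_ge h
  have hβ : 1 - β < (6 - 4 * Real.sqrt 2) / Real.log q := by
    have := min_le_left β β'; linarith
  have hβ' : 1 - β' < (6 - 4 * Real.sqrt 2) / Real.log q := by
    have := min_le_right β β'; linarith
  exact hne (realZeros_subsingleton hprim hquad h1 ⟨hz, hβ⟩ ⟨hz', hβ'⟩)

namespace HoffsteinWindow

/-! ### Reduction of an imprimitive quadratic character to its primitive character -/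

/-- The primitive character inducing a quadratic character is quadratic. [folklore] -/
private theorem isQuadratic_primitiveCharacter {q : ℕ} [NeZero q] {χ : DirichletCharacter ℂ q}
    (hquad : χ.IsQuadratic) : χ.primitiveCharacter.IsQuadratic := by
  haveI : NeZero χ.conductor := ⟨χ.conductor_ne_zero⟩
  have hsq : χ ^ 2 = 1 := hquad.sq_eq_one
  have hsq₀ : χ.primitiveCharacter ^ 2 = 1 := by
    refine (changeLevel_eq_one_iff χ.conductor_dvd_level).mp ?_
    rw [map_pow, changeLevel_primitiveCharacter, hsq]
  intro a
  by_cases ha : IsUnit a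
  · right
    have h := MulChar.pow_apply' χ.primitiveCharacter two_ne_zero a
    rw [hsq₀, MulChar.one_apply ha] at h
    have h2 : χ.primitiveCharacter a * χ.primitiveCharacter a = 1 := by
      rw [← pow_two]; exact h.symm
    rcases mul_self_eq_one_iff.mp h2 with h' | h'
    · exact Or.inl h'
    · exact Or.inr h'
  · exact Or.inl (χ.primitiveCharacter.map_nonunit ha)

/-- The primitive character inducing `χ ≠ 1` is `≠ 1`. [folklore] -/
private theorem primitiveCharacter_ne_one {q : ℕ} [NeZero q] {χ : DirichletCharacter ℂ q} (h1 : χ ≠ 1) :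
    χ.primitiveCharacter ≠ 1 := by
  intro h
  apply h1
  rw [← changeLevel_primitiveCharacter χ, h, map_one]

/-- A real zero `β > 0` of `L(s, χ)` is a zero of `L(s, χ*)` for the primitive character `χ*`
inducing `χ` (the Euler factors `1 − χ*(p) p^{−β}`, `p ∣ q`, do not vanish for `β > 0`).
[folklore] -/
private theorem primitiveCharacter_LFunction_eq_zero {q : ℕ} [NeZero q] {χ : DirichletCharacter ℂ q}
    [NeZero χ.conductor] (h1 : χ ≠ 1) {β : ℝ} (hβ : 0 < β) (hz : χ.LFunction β = 0) :
    χ.primitiveCharacter.LFunction β = 0 := by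
  have hne := primitiveCharacter_ne_one h1
  have h := LFunction_changeLevel χ.conductor_dvd_level χ.primitiveCharacter (s := (β : ℂ))
    (Or.inl hne)
  rw [changeLevel_primitiveCharacter, hz] at h
  rcases mul_eq_zero.mp h.symm with h0 | h0
  · exact h0
  · exfalso
    obtain ⟨p, hp, hp0⟩ := Finset.prod_eq_zero_iff.mp h0
    have hpp : p.Prime := Nat.prime_of_mem_primeFactors hp
    have hp2 : (2 : ℝ) ≤ p := by exact_mod_cast hpp.two_le
    -- `‖χ*(p) p^{−β}‖ ≤ p^{−β} < 1`
    have hnorm : ‖χ.primitiveCharacter p * (p : ℂ) ^ (-(β : ℂ))‖ < 1 := by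
      rw [norm_mul, Complex.norm_natCast_cpow_of_pos hpp.pos]
      have hre : (-(β : ℂ)).re = -β := by simp
      rw [hre]
      have h1' : ((p : ℝ)) ^ (-β) < 1 :=
        Real.rpow_lt_one_of_one_lt_of_neg (by linarith) (by linarith)
      have hχ := DirichletCharacter.norm_le_one χ.primitiveCharacter (p : ZMod χ.conductor)
      have h0' : 0 ≤ (p : ℝ) ^ (-β) := Real.rpow_nonneg (by linarith) _
      calc ‖χ.primitiveCharacter p‖ * (p : ℝ) ^ (-β) ≤ 1 * (p : ℝ) ^ (-β) :=
            mul_le_mul_of_nonneg_right hχ h0'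
        _ < 1 := by rw [one_mul]; exact h1'
    have heq : χ.primitiveCharacter p * (p : ℂ) ^ (-(β : ℂ)) = 1 := by
      have := sub_eq_zero.mp hp0
      exact this.symm
    rw [heq, norm_one] at hnorm
    exact lt_irrefl _ hnorm

end HoffsteinWindow

/-- **Hoffstein's window for every real non-principal character, Page shape**: for `χ` quadratic,
`χ ≠ χ₀`, mod `q` (primitive or not), two distinct real zeros `β ≠ β'` of `L(s, χ)` satisfy
`min{β, β'} ≤ 1 − (6 − 4√2)/log q`. (Imprimitive `χ`: both zeros, if in the window, are `> 0`, hence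
zeros of `L(s, χ*)`, `χ*` mod `q* ∣ q`, and `(6 − 4√2)/log q ≤ (6 − 4√2)/log q*`.)
[cite: Hoffstein1980SiegelTatuzawa, Lemma 2 p. 169] [cite: Chen2007SiegelTatuzawaHoffstein, Lemma 1 p. 362] -/
theorem min_realZeros_le_of_isQuadratic {q : ℕ} [NeZero q] {χ : DirichletCharacter ℂ q}
    (hquad : χ.IsQuadratic) (h1 : χ ≠ 1) {β β' : ℝ} (hne : β ≠ β')
    (hz : χ.LFunction β = 0) (hz' : χ.LFunction β' = 0) :
    min β β' ≤ 1 - (6 - 4 * Real.sqrt 2) / Real.log q := by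
  haveI : NeZero χ.conductor := ⟨χ.conductor_ne_zero⟩
  set c : ℝ := 6 - 4 * Real.sqrt 2 with hc
  obtain ⟨hc1, hc2⟩ := NumberField.chenConst_bounds
  have hq1 : 1 < q := one_lt_level h1
  -- the conductor `q*` of `χ`: `2 ≤ q* ≤ q`
  have hcond1 : χ.conductor ≠ 1 := fun h ↦ h1 (eq_one_iff_conductor_eq_one.mpr h)
  have hcond2 : 2 ≤ χ.conductor := by
    have := χ.conductor_ne_zero; omega
  have hcondq : χ.conductor ≤ q := Nat.le_of_dvd (by omega) χ.conductor_dvd_level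
  have hlogq' : 0 < Real.log (χ.conductor : ℝ) := Real.log_pos (by exact_mod_cast hcond2)
  have hlogle : Real.log (χ.conductor : ℝ) ≤ Real.log (q : ℝ) :=
    Real.log_le_log (by positivity) (by exact_mod_cast hcondq)
  have hlogq : 0 < Real.log (q : ℝ) := lt_of_lt_of_le hlogq' hlogle
  by_contra h
  have hlt := lt_of_not_ge h
  -- both zeros lie in the window, in particular they are `> 0`
  have hwin : c / Real.log q < 1 := by
    rw [div_lt_one hlogq]
    have h2q : (2 : ℝ) ≤ q := by exact_mod_cast hq1
    have hlog2 : (0.6931471803 : ℝ) < Real.log 2 := Real.log_two_gt_d9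
    have := Real.log_le_log (by norm_num) h2q
    linarith
  have hβw : 1 - β < c / Real.log q := by have := min_le_left β β'; linarith
  have hβ'w : 1 - β' < c / Real.log q := by have := min_le_right β β'; linarith
  have hβ0 : 0 < β := by linarith
  have hβ'0 : 0 < β' := by linarith
  -- pass to the primitive character
  have hzp := HoffsteinWindow.primitiveCharacter_LFunction_eq_zero h1 hβ0 hz
  have hzp' := HoffsteinWindow.primitiveCharacter_LFunction_eq_zero h1 hβ'0 hz'
  have hmono : c / Real.log q ≤ c / Real.log (χ.conductor : ℝ) :=
    div_le_div_of_nonneg_left (by linarith) hlogq' hlogle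
  have hsub := HoffsteinWindow.realZeros_subsingleton χ.primitiveCharacter_isPrimitive
    (HoffsteinWindow.isQuadratic_primitiveCharacter hquad)
    (HoffsteinWindow.primitiveCharacter_ne_one h1)
  exact hne (hsub ⟨hzp, by linarith⟩ ⟨hzp', by linarith⟩)

/-! ### Thorner–Zaman 2024, Corollary 2.5 from Lemma 2.4 and Platt 2016 alone -/

/-- `pageConst < 6 − 4√2` (`0.155… < 1/5 < 0.343…`).
[cite: ThornerZaman2024LogFree, Corollary 2.5 (the constant)] -/
theorem ThornerZaman2024.pageConst_lt_chenConst : ThornerZaman2024.pageConst < 6 - 4 * Real.sqrt 2 := by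
  have h1 := ThornerZaman2024.pageConst_lt_one_fifth
  have h2 := NumberField.chenConst_bounds.1
  linarith

/-- **Thorner–Zaman 2024, Corollary 2.5 (tree rendering `thornerZaman2024_corollary25`) from
Lemma 2.4 and Platt 2016, Theorems 7.1–7.2 — with NO single-character Page hypothesis.** The tree's
`thornerZaman2024_corollary25_of_lemma24_platt_singlePage` takes, besides the named facts
`thornerZaman2024_lemma24`, `platt2016_theorem71`, `platt2016_theorem72`, an inline binder "two distinct
real zeros of a quadratic `L(s, χ)`, `χ ≠ χ₀` mod `q ≥ 3`, have `min{β, β'} ≤ 1 − c₁/log q`" for some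
`c₁ > pageConst`; Hoffstein's window (`min_realZeros_le_of_isQuadratic`, `c₁ = 6 − 4√2 = 0.343… >
pageConst = 0.155…`) discharges it. [cite: ThornerZaman2024LogFree, Corollary 2.5]
[cite: Hoffstein1980SiegelTatuzawa, Lemma 2 p. 169] -/
theorem thornerZaman2024_corollary25_of_lemma24_platt (h24 : thornerZaman2024_lemma24)
    (h71 : platt2016_theorem71) (h72 : platt2016_theorem72) : thornerZaman2024_corollary25 :=
  thornerZaman2024_corollary25_of_lemma24_platt_singlePage h24 h71 h72
    ThornerZaman2024.pageConst_lt_chenConst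
    (fun _ _ _ _ hquad hne _ _ hββ hz hz' ↦ min_realZeros_le_of_isQuadratic hquad hne hββ hz hz')

end Literature.NumberTheory.LFunctions
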